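import Summits.QuantumFields.BalabanUV.T4Continuum.Support.NE7NearFlatSharpHolonomyPrep
import Summits.QuantumFields.BalabanUV.T4Continuum.Support.NE7NearFlatSharpAbelian
import HarnessLib

/-!
# NE7NearFlatSharpHolonomy — THE COMMUTATOR-HOLONOMY DATUM: a `2t²`-small, `N`-periodic `U(n)`-valued configuration on `ℤ⁴` (`card n ≥ 2`), bondwise within `t`
# of the trivial datum, at bondwise distance `≥ t ∕ (π(1 + √(card n − 1))·N)` from EVERY flat periodic `U(n)`-valued configuration modulo EVERY periodic unitary
# gauge — so F29's «almost flat ⇒ near flat» threshold is NOT LINEAR in the target radius: `γ(ε′) ≤ 2π²(1 + √(card n − 1))²·N²·ε′²`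

Cell `pub-balaban`, rung (B)+1 sub-cell t4, lineage `b2b-balaban-t4-ne7b-p1` (row NE7b OWNER + CRUX PROVER), generation 157; junction census for the NE7 road's
located gap (G2) of `t4/b2b-balaban-t4-ne7-p1-g113/ROAD-G113.md` §6 («(G2) class radius LINEAR in the datum radius … an explicit γ = c(n)ε′∕N via gen 26's
`TorusSmallFieldGlobalGauge` would make δ_V explicit and linear in ε»; located at F29 `NE7SoftDataPath.exists_flat_near`).  Part 3b of 3 (3a
`NE7NearFlatSharpHolonomyPrep`: the matrix algebra; 2 `NE7NearFlatSharpAbelian`: the `≍ N·γ` witness; 1 `NE7NearFlatSharpPrep`: the loop∕axis letters).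
THE WITNESS ([folklore]).  `V(x, 0) = H₀` on the slice `x₀ ≡ 0 (N)`, `V(x, 1) = H₁` on `x₁ ≡ 0 (N)`, all other bonds `1`, with `H₀ = D(e^{it})`,
`H₁ = 1 + (e^{it} − 1)P` (`P` the projection onto `(e_{i₀} + e_{i₁})∕√2`).  Every plaquette variable is `1` or a commutator `H₀H₁H₀⁻¹H₁⁻¹` (or its inverse), within
`‖[H₀, H₁]‖ ≤ 2|e^{it} − 1|² ≤ 2t²` of `1`; the axis holonomies from `0` are `H₀`, `H₁`.  If `‖V^u − F‖ ≤ ρ` bondwise (flat periodic `F`, periodic unitary `u`), the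
axis letter of part 1 gives a COMMUTING unitary pair within `N·ρ` of `(H₀, H₁)`, and part 3a's entry inequality forces `|e^{it} − 1| ≤ 2(1 + √(card n − 1))·N·ρ`.
WHAT ([folklore]; 0 def, 0 sorry; the configuration enters through EQUATIONAL HYPOTHESES `hV0`, `hV1`, `hV`).  §1 wrap configurations over two unitary units:
`bond_add_e`, `hol_plaqWord_eq`, `norm_comm_units_sub_one_le`, `isUnitaryCfg_wrap`, `isPeriodicCfg_wrap`, **`smallField_wrap`** (`SmallField V ‖H₀H₁ − H₁H₀‖`),
`norm_bond_sub_one_le_wrap`, **`hol_axis_wrap`** (`V([0, Ne_κ]) = H_κ`); §2 **`exists_smallField_far_from_flat_sqrt`** — `card n ≥ 2`, `N ≥ 1`, `0 ≤ t ≤ π`: a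
`U(n)`-valued `N`-periodic `V` with `SmallField V (2t²)`, bonds within `t` of `1`, and `t ∕ (π(1 + √(card n − 1))·N) ≤ ρ` whenever `‖V^u(b) − F(b)‖ ≤ ρ` at all bonds
for a flat `N`-periodic `U(n)`-valued `F` and an `N`-periodic unitary `u`; §3 in F29's currency (relative distance `‖F(b)⁻¹V(b) − 1‖`, no gauge):
`norm_inv_mul_sub_one_eq`, **`exists_flat_near_rate_ge`** (part 2 read off: `γ(ε′) ≤ 8π·ε′∕N`) and **`exists_flat_near_not_linear`** (`√(γ∕2) ≤ π(1 + √(card n − 1))·N·ε′`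
for `γ ≤ 2π²`): F29's threshold is `O(ε′∕N)` AND `O(N²ε′²)` — neither uniform in the torus size nor linear in the target radius.
HONEST FRAMING (page 1): explicit lattice configurations and elementary matrix algebra; statements about the MECHANISM «distance to flat data» of F29 only — BOTH
witnesses lie on small-curvature PATHS from the trivial datum (`τ ↦ (D(e^{iτt}), 1 + (e^{iτt} − 1)P)` has plaquettes within `2τ²t²` of `1`), so they do NOT obstruct
the continuity method along paths (F28 `oneStep_of_path_ape_repWgauge`), whose uniform∕linear radius is a statement about small-curvature path-connectedness of the
`γ`-small class; F29, the road's ENDs and `hsector` are untouched; nothing of Bałaban's asserted; NE3∕NE7 NOT proved; row NE7b (`T4WeightBudget.RelWeightBound`)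
NOT PRINTED ∕ NOT PROVED; spine count = dagwriter's call; finite T⁴ rung (B)+1 — NOT infinite volume, NOT mass gap, NOT BetaPertH, NOT Clay (continuum YM on
T⁴ ⇐ BetaPertH ∧ nine spine estimates).
-/

set_option autoImplicit false

open scoped BigOperators Matrix Matrix.Norms.L2Operator
open Finset NormedSpace Complex

namespace Summit.QuantumFields.BalabanUV.T4Continuum.NE7NearFlatSharpHolonomy

open Literature.MathematicalPhysics.QuantumFieldTheory.Balaban1983to89
open B7Prop1Explicit B7Prop2Explicit
open T4AveragingDeficitWall hiding Site Plane Plaq Bond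
open T4AveragingDeficitWallBoundary (IsPeriodicCfg)
open NE3EnergyShapes (IsUnitarySite IsPeriodicSite)
open TorusSmallFieldGlobalGaugeSharpPrep
open NE7NearFlatSharpPrep NE7NearFlatSharpHolonomyPrep NE7NearFlatSharpAbelian
open UnitaryCayleyPath (norm_coe_le_one)

noncomputable section

variable {n : Type*} [Fintype n] [DecidableEq n]

/-! ## §1 Wrap configurations: `V(x,0) = H₀` on `x₀ ≡ 0`, `V(x,1) = H₁` on `x₁ ≡ 0`, all other bonds `1` -/

section Wrap

variable {N : ℕ} {H₀ H₁ : (Matrix n n ℂ)ˣ} {V : Site 4 → Fin 4 → (Matrix n n ℂ)ˣ}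
  (hV0 : ∀ x : Site 4, V x 0 = if x 0 % (N : ℤ) = 0 then H₀ else 1) (hV1 : ∀ x : Site 4, V x 1 = if x 1 % (N : ℤ) = 0 then H₁ else 1)
  (hV : ∀ (x : Site 4) (μ : Fin 4), μ ≠ 0 → μ ≠ 1 → V x μ = 1)
include hV0 hV1 hV

/-- A bond in direction `μ` depends on the coordinate `x_μ` only: `V(x + e_κ, μ) = V(x, μ)` for `κ ≠ μ`. [folklore] -/
theorem bond_add_e (x : Site 4) {κ μ : Fin 4} (hκμ : κ ≠ μ) : V (x + e κ) μ = V x μ := by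
  by_cases h0 : μ = 0
  · subst h0; rw [hV0, hV0, add_e_apply, if_neg (Ne.symm hκμ), add_zero]
  by_cases h1 : μ = 1
  · subst h1; rw [hV1, hV1, add_e_apply, if_neg (Ne.symm hκμ), add_zero]
  rw [hV _ μ h0 h1, hV x μ h0 h1]

/-- Every bond is `1`, or `H₀` in direction `0`, or `H₁` in direction `1`. [folklore] -/
theorem bond_cases (x : Site 4) (μ : Fin 4) : V x μ = 1 ∨ (μ = 0 ∧ V x μ = H₀) ∨ (μ = 1 ∧ V x μ = H₁) := by
  by_cases h0 : μ = 0
  · subst h0; rw [hV0]; split_ifs <;> simp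
  by_cases h1 : μ = 1
  · subst h1; rw [hV1]; split_ifs <;> simp
  exact Or.inl (hV x μ h0 h1)

/-- THE PLAQUETTE VARIABLES ARE GROUP COMMUTATORS of the two bonds at the base point. [folklore] -/
theorem hol_plaqWord_eq (x : Site 4) {κ μ : Fin 4} (hκμ : κ ≠ μ) : hol V x (plaqWord κ μ) = V x κ * V x μ * (V x κ)⁻¹ * (V x μ)⁻¹ := by
  rw [← lplaqWord_true, hol_lplaqWord, stepHol_true, stepHol_true, Letter.vec_true, bond_add_e hV0 hV1 hV x hκμ, bond_add_e hV0 hV1 hV x (Ne.symm hκμ)]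

omit hV0 hV1 hV in
/-- `‖g g′ g⁻¹ g′⁻¹ − 1‖ ≤ ‖g g′ − g′ g‖` for unitary units. [folklore] -/
theorem norm_comm_units_sub_one_le {g g' : (Matrix n n ℂ)ˣ} (hg : g ∈ unitaryUnits (Matrix n n ℂ)) (hg' : g' ∈ unitaryUnits (Matrix n n ℂ)) :
    ‖((g * g' * g⁻¹ * g'⁻¹ : (Matrix n n ℂ)ˣ) : Matrix n n ℂ) - 1‖ ≤ ‖(g : Matrix n n ℂ) * (g' : Matrix n n ℂ) - (g' : Matrix n n ℂ) * (g : Matrix n n ℂ)‖ := by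
  have e : ((g * g' * g⁻¹ * g'⁻¹ : (Matrix n n ℂ)ˣ) : Matrix n n ℂ) - 1
      = ((g : Matrix n n ℂ) * (g' : Matrix n n ℂ) - (g' : Matrix n n ℂ) * (g : Matrix n n ℂ)) * ((g⁻¹ : (Matrix n n ℂ)ˣ) : Matrix n n ℂ) * ((g'⁻¹ : (Matrix n n ℂ)ˣ) : Matrix n n ℂ) := by
    have h1 : (g' : Matrix n n ℂ) * (g : Matrix n n ℂ) * ((g⁻¹ : (Matrix n n ℂ)ˣ) : Matrix n n ℂ) * ((g'⁻¹ : (Matrix n n ℂ)ˣ) : Matrix n n ℂ) = 1 := by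
      rw [mul_assoc (g' : Matrix n n ℂ), Units.mul_inv, mul_one, Units.mul_inv]
    simp only [Units.val_mul, sub_mul]
    rw [h1]
  rw [e]
  calc _ ≤ ‖(g : Matrix n n ℂ) * (g' : Matrix n n ℂ) - (g' : Matrix n n ℂ) * (g : Matrix n n ℂ)‖ * ‖((g⁻¹ : (Matrix n n ℂ)ˣ) : Matrix n n ℂ)‖
        * ‖((g'⁻¹ : (Matrix n n ℂ)ˣ) : Matrix n n ℂ)‖ := (norm_mul_le _ _).trans (mul_le_mul_of_nonneg_right (norm_mul_le _ _) (norm_nonneg _))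
    _ ≤ ‖(g : Matrix n n ℂ) * (g' : Matrix n n ℂ) - (g' : Matrix n n ℂ) * (g : Matrix n n ℂ)‖ * 1 * 1 := by
        gcongr
        · exact norm_coe_le_one ((unitaryUnits _).inv_mem hg)
        · exact norm_coe_le_one ((unitaryUnits _).inv_mem hg')
    _ = _ := by ring

/-- THE WRAP CONFIGURATION IS `U(n)`-VALUED. [folklore] -/
theorem isUnitaryCfg_wrap (hH₀ : H₀ ∈ unitaryUnits (Matrix n n ℂ)) (hH₁ : H₁ ∈ unitaryUnits (Matrix n n ℂ)) : IsUnitaryCfg V := by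
  intro x μ
  rcases bond_cases hV0 hV1 hV x μ with h | ⟨-, h⟩ | ⟨-, h⟩ <;> rw [h]
  exacts [(unitaryUnits _).one_mem, hH₀, hH₁]

/-- THE WRAP CONFIGURATION IS `N`-PERIODIC. [folklore] -/
theorem isPeriodicCfg_wrap : IsPeriodicCfg V (N : ℤ) := by
  intro x κ μ
  have hmod : ∀ ν : Fin 4, (x + (N : ℤ) • e κ : Site 4) ν % (N : ℤ) = x ν % (N : ℤ) := by
    intro ν
    rw [add_zsmul_e_apply]
    split_ifs
    · rw [Int.add_emod_right]
    · rw [add_zero]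
  by_cases h0 : μ = 0
  · subst h0; rw [hV0, hV0, hmod]
  by_cases h1 : μ = 1
  · subst h1; rw [hV1, hV1, hmod]
  rw [hV _ μ h0 h1, hV x μ h0 h1]

/-- **THE WRAP CONFIGURATION IS SMALL-FIELD WITH RADIUS `‖H₀H₁ − H₁H₀‖`** (every plaquette variable is `1` or `(H₀H₁H₀⁻¹H₁⁻¹)^{±1}`). [folklore] -/
theorem smallField_wrap (hH₀ : H₀ ∈ unitaryUnits (Matrix n n ℂ)) (hH₁ : H₁ ∈ unitaryUnits (Matrix n n ℂ)) {C : ℝ}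
    (hC : ‖(H₀ : Matrix n n ℂ) * (H₁ : Matrix n n ℂ) - (H₁ : Matrix n n ℂ) * (H₀ : Matrix n n ℂ)‖ ≤ C) : SmallField V C := by
  have hC0 : 0 ≤ C := le_trans (norm_nonneg _) hC
  have hVu := isUnitaryCfg_wrap hV0 hV1 hV hH₀ hH₁
  intro x κ μ hκμ
  rw [hol_plaqWord_eq hV0 hV1 hV x hκμ]
  refine (norm_comm_units_sub_one_le (hVu x κ) (hVu x μ)).trans ?_
  rcases bond_cases hV0 hV1 hV x κ with hκ1 | ⟨hκ0, hκH⟩ | ⟨hκ1', hκH⟩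
  · rw [hκ1, Units.val_one, one_mul, mul_one, sub_self, norm_zero]; exact hC0
  · rcases bond_cases hV0 hV1 hV x μ with hμ1 | ⟨hμ0, -⟩ | ⟨-, hμH⟩
    · rw [hμ1, Units.val_one, one_mul, mul_one, sub_self, norm_zero]; exact hC0
    · exact absurd (hκ0.trans hμ0.symm) hκμ
    · rw [hκH, hμH]; exact hC
  · rcases bond_cases hV0 hV1 hV x μ with hμ1 | ⟨-, hμH⟩ | ⟨hμ1', -⟩
    · rw [hμ1, Units.val_one, one_mul, mul_one, sub_self, norm_zero]; exact hC0
    · rw [hκH, hμH, norm_sub_rev]; exact hC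
    · exact absurd (hκ1'.trans hμ1'.symm) hκμ

/-- EVERY BOND IS WITHIN `max ‖H_κ − 1‖` OF `1`. [folklore] -/
theorem norm_bond_sub_one_le_wrap {δ : ℝ} (h₀ : ‖(H₀ : Matrix n n ℂ) - 1‖ ≤ δ) (h₁ : ‖(H₁ : Matrix n n ℂ) - 1‖ ≤ δ) (x : Site 4) (μ : Fin 4) :
    ‖((V x μ : (Matrix n n ℂ)ˣ) : Matrix n n ℂ) - 1‖ ≤ δ := by
  have hδ : 0 ≤ δ := le_trans (norm_nonneg _) h₀
  rcases bond_cases hV0 hV1 hV x μ with h | ⟨-, h⟩ | ⟨-, h⟩ <;> rw [h]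
  · rw [Units.val_one, sub_self, norm_zero]; exact hδ
  exacts [h₀, h₁]

omit hV in
/-- **THE AXIS HOLONOMIES FROM `0` ARE `H₀` AND `H₁`** (`N ≥ 1`: the first bond is the wrap bond, the remaining `N − 1` are trivial). [folklore] -/
theorem hol_axis_wrap (hN : 1 ≤ N) : hol V 0 (seg (0 : Fin 4) (N : ℤ)) = H₀ ∧ hol V 0 (seg (1 : Fin 4) (N : ℤ)) = H₁ := by
  obtain ⟨N', rfl⟩ : ∃ N', N = N' + 1 := ⟨N - 1, by omega⟩
  have key : ∀ (κ : Fin 4) (Hκ : (Matrix n n ℂ)ˣ), (∀ x : Site 4, V x κ = if x κ % ((N' + 1 : ℕ) : ℤ) = 0 then Hκ else 1) →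
      hol V 0 (seg κ ((N' + 1 : ℕ) : ℤ)) = Hκ := by
    intro κ Hκ hκ
    rw [seg_natCast, List.replicate_succ, hol_cons, stepHol_true, Letter.vec_true, zero_add, hκ 0]
    simp only [Pi.zero_apply, EuclideanDomain.zero_mod, if_true]
    rw [hol_replicate_true_of_eq V κ 1 N' (e κ) fun j hj => ?_, one_pow, mul_one]
    rw [hκ, if_neg]
    rw [add_zsmul_e_apply, e_apply, if_pos rfl, if_pos rfl]
    rw [Int.emod_eq_of_lt (by positivity) (by push_cast; omega)]
    omega
  exact ⟨key 0 H₀ hV0, key 1 H₁ hV1⟩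

end Wrap

/-! ## §2 THE NONLINEAR WITNESS ASSEMBLED -/

section Witness

/-- **A `2t²`-SMALL DATUM AT DISTANCE `≳ t∕N` FROM THE FLAT DATA MODULO PERIODIC GAUGE.**  Let `card n ≥ 2`, `N ≥ 1`, `0 ≤ t ≤ π`.  There is a `U(n)`-valued
`N`-periodic configuration `V` on `ℤ⁴` with `SmallField V (2t²)` and every bond within `t` of `1` such that: for every `U(n)`-valued `N`-periodic `F` with all
plaquette variables `1`, every unitary `N`-periodic site field `u` and every `ρ` with `‖V^u(b) − F(b)‖ ≤ ρ` at all bonds,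
`t ∕ (π·(1 + √(card n − 1))·N) ≤ ρ`.  (The wrap configuration of §1 with `H₀ = D(e^{it})`, `H₁ = 1 + (e^{it} − 1)P`; part 1's axis letter; part 3a's entry
inequality; `|e^{it} − 1| = 2 sin(t∕2) ≥ 2t∕π`.) [folklore] -/
theorem exists_smallField_far_from_flat_sqrt (hn : 1 < Fintype.card n) {N : ℕ} (hN : 1 ≤ N) {t : ℝ} (ht0 : 0 ≤ t) (htπ : t ≤ Real.pi) :
    ∃ V : Site 4 → Fin 4 → (Matrix n n ℂ)ˣ, IsUnitaryCfg V ∧ IsPeriodicCfg V (N : ℤ) ∧ SmallField V (2 * t ^ 2) ∧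
      (∀ (x : Site 4) (κ : Fin 4), ‖((V x κ : (Matrix n n ℂ)ˣ) : Matrix n n ℂ) - 1‖ ≤ t) ∧
      ∀ F : Site 4 → Fin 4 → (Matrix n n ℂ)ˣ, IsUnitaryCfg F → IsPeriodicCfg F (N : ℤ) →
        (∀ (x : Site 4) (κ μ : Fin 4), κ ≠ μ → hol F x (plaqWord κ μ) = 1) →
        ∀ u : Site 4 → (Matrix n n ℂ)ˣ, IsUnitarySite u → IsPeriodicSite u (N : ℤ) → ∀ ρ : ℝ,
          (∀ (x : Site 4) (κ : Fin 4), ‖((gaugeAct u V x κ : (Matrix n n ℂ)ˣ) : Matrix n n ℂ) - (F x κ : Matrix n n ℂ)‖ ≤ ρ) →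
            t / (Real.pi * (1 + Real.sqrt ((Fintype.card n : ℝ) - 1)) * N) ≤ ρ := by
  obtain ⟨i₀, i₁, h01⟩ := Fintype.exists_pair_of_one_lt_card hn
  haveI : Nonempty n := ⟨i₀⟩
  -- the pair `(h₀, h₁)`
  set z : ℂ := cexp (I * t) with hz
  have hz1 : ‖z‖ = 1 := by rw [hz, Complex.norm_exp_I_mul_ofReal]
  set σ : ℝ := ‖z - 1‖ with hσ
  have hσt : σ ≤ t := by
    rw [hσ, hz]; exact (Real.norm_exp_I_mul_ofReal_sub_one_le).trans (by rw [Real.norm_eq_abs, abs_of_nonneg ht0])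
  have hσlow : 2 / Real.pi * t ≤ σ := by
    rw [hσ, hz, Complex.norm_exp_I_mul_ofReal_sub_one, Real.norm_eq_abs, abs_mul, abs_two]
    have hs : 2 / Real.pi * (t / 2) ≤ Real.sin (t / 2) := Real.mul_le_sin (by positivity) (by linarith)
    rw [abs_of_nonneg (le_trans (by positivity) hs)]
    linarith
  let χ : n → ℂ := fun a => if a = i₀ ∨ a = i₁ then 1 else 0
  have hχ : ∀ a, χ a = if a = i₀ ∨ a = i₁ then 1 else 0 := fun _ => rfl
  let P : Matrix n n ℂ := Matrix.of fun a b => χ a * χ b / 2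
  have hP : ∀ a b, P a b = χ a * χ b / 2 := fun _ _ => rfl
  set h₀ : Matrix n n ℂ := Matrix.diagonal (Function.update (1 : n → ℂ) i₀ z) with hh₀
  set h₁ : Matrix n n ℂ := 1 + (z - 1) • P with hh₁
  have hh₀u : h₀ ∈ unitary (Matrix n n ℂ) := phaseMat_mem_unitary i₀ hz1
  have hh₁u : h₁ ∈ unitary (Matrix n n ℂ) := hOne_mem_unitary h01 hχ hP hh₁ hz1
  let H₀ : (Matrix n n ℂ)ˣ := ⟨h₀, star h₀, Unitary.mul_star_self_of_mem hh₀u, Unitary.star_mul_self_of_mem hh₀u⟩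
  let H₁ : (Matrix n n ℂ)ˣ := ⟨h₁, star h₁, Unitary.mul_star_self_of_mem hh₁u, Unitary.star_mul_self_of_mem hh₁u⟩
  have hH₀v : (H₀ : Matrix n n ℂ) = h₀ := rfl
  have hH₁v : (H₁ : Matrix n n ℂ) = h₁ := rfl
  have hH₀ : H₀ ∈ unitaryUnits (Matrix n n ℂ) := mem_unitaryUnits.mpr hh₀u
  have hH₁ : H₁ ∈ unitaryUnits (Matrix n n ℂ) := mem_unitaryUnits.mpr hh₁u
  have hn0 : ‖h₀ - 1‖ ≤ σ := norm_phaseMat_sub_one_le i₀ z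
  have hn1 : ‖h₁ - 1‖ ≤ σ := norm_hOne_sub_one_le h01 hχ hP hh₁
  -- the configuration
  let V : Site 4 → Fin 4 → (Matrix n n ℂ)ˣ := fun x μ =>
    if μ = 0 then (if x 0 % (N : ℤ) = 0 then H₀ else 1) else if μ = 1 then (if x 1 % (N : ℤ) = 0 then H₁ else 1) else 1
  have hV0 : ∀ x : Site 4, V x 0 = if x 0 % (N : ℤ) = 0 then H₀ else 1 := fun x => by simp [V]
  have hV1 : ∀ x : Site 4, V x 1 = if x 1 % (N : ℤ) = 0 then H₁ else 1 := fun x => by simp [V]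
  have hV : ∀ (x : Site 4) (μ : Fin 4), μ ≠ 0 → μ ≠ 1 → V x μ = 1 := fun x μ h0 h1 => by simp [V, h0, h1]
  have hVu : IsUnitaryCfg V := isUnitaryCfg_wrap hV0 hV1 hV hH₀ hH₁
  -- the commutator
  have hcomm : ‖(H₀ : Matrix n n ℂ) * (H₁ : Matrix n n ℂ) - (H₁ : Matrix n n ℂ) * (H₀ : Matrix n n ℂ)‖ ≤ 2 * t ^ 2 := by
    rw [hH₀v, hH₁v]
    have e : h₀ * h₁ - h₁ * h₀ = (h₀ - 1) * (h₁ - 1) - (h₁ - 1) * (h₀ - 1) := by noncomm_ring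
    rw [e]
    have hσ0 : 0 ≤ σ := norm_nonneg _
    calc ‖(h₀ - 1) * (h₁ - 1) - (h₁ - 1) * (h₀ - 1)‖ ≤ ‖(h₀ - 1) * (h₁ - 1)‖ + ‖(h₁ - 1) * (h₀ - 1)‖ := norm_sub_le _ _
      _ ≤ ‖h₀ - 1‖ * ‖h₁ - 1‖ + ‖h₁ - 1‖ * ‖h₀ - 1‖ := add_le_add (norm_mul_le _ _) (norm_mul_le _ _)
      _ ≤ σ * σ + σ * σ := add_le_add (mul_le_mul hn0 hn1 (norm_nonneg _) hσ0) (mul_le_mul hn1 hn0 (norm_nonneg _) hσ0)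
      _ ≤ 2 * t ^ 2 := by nlinarith
  refine ⟨V, hVu, isPeriodicCfg_wrap hV0 hV1 hV, smallField_wrap hV0 hV1 hV hH₀ hH₁ hcomm,
    fun x κ => norm_bond_sub_one_le_wrap hV0 hV1 hV (hn0.trans hσt) (hn1.trans hσt) x κ, fun F hFu hFP hflat u hu huP ρ hρ => ?_⟩
  -- a commuting pair near `(H₀, H₁)`
  obtain ⟨g₀, g₁, -, -, hcg, hg₀, hg₁⟩ := exists_commuting_pair_near_axisHol hVu hFu hFP hflat hu huP hρ (0 : Fin 4) (1 : Fin 4)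
  obtain ⟨hA0, hA1⟩ := hol_axis_wrap hV0 hV1 hN
  rw [hA0] at hg₀
  rw [hA1] at hg₁
  set ε : ℝ := (N : ℝ) * ρ with hε
  have hε0 : 0 ≤ ε := le_trans (norm_nonneg _) hg₀
  -- entrywise bounds from the operator norm
  have entry : ∀ (A : Matrix n n ℂ) (a b : n), ‖A a b‖ ≤ ‖A‖ := by
    intro A a b
    set v : EuclideanSpace ℂ n := PiLp.single 2 b (1 : ℂ) with hv
    have hv1 : ‖v‖ = 1 := by rw [hv, PiLp.norm_single, norm_one]
    have h1 := Matrix.l2_opNorm_mulVec A v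
    rw [hv1, mul_one] at h1
    have h2 : ‖((EuclideanSpace.equiv n ℂ).symm (Matrix.mulVec A v.ofLp)) a‖ ≤ ‖(EuclideanSpace.equiv n ℂ).symm (Matrix.mulVec A v.ofLp)‖ :=
      PiLp.norm_apply_le _ a
    have h3 : ((EuclideanSpace.equiv n ℂ).symm (Matrix.mulVec A v.ofLp)) a = A a b := by
      have : v.ofLp = Pi.single b 1 := by rw [hv]; rfl
      simp [this]
    rw [h3] at h2
    exact h2.trans h1
  have hE0 : ∀ a b, ‖((g₀ : Matrix n n ℂ) - h₀) a b‖ ≤ ε := fun a b =>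
    (entry _ a b).trans (by rw [← hH₀v, norm_sub_rev]; exact hg₀)
  have hE1 : ∀ a b, ‖((g₁ : Matrix n n ℂ) - h₁) a b‖ ≤ ε := fun a b =>
    (entry _ a b).trans (by rw [← hH₁v, norm_sub_rev]; exact hg₁)
  have hcg' : (g₀ : Matrix n n ℂ) * (g₁ : Matrix n n ℂ) = (g₁ : Matrix n n ℂ) * (g₀ : Matrix n n ℂ) := by
    rw [← Units.val_mul, hcg, Units.val_mul]
  obtain ⟨e00, e11, erow, ecol⟩ := phaseMat_entries h01 z
  rw [← hh₀] at e00 e11 erow ecol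
  obtain ⟨f10, fdiag, frow, fcol⟩ := hOne_entries h01 hχ hP hh₁
  have hineq := entry_ineq_of_commuting_near h01 hε0 hcg' hE0 hE1 erow ecol frow fcol fdiag
  rw [f10, e00, e11, norm_div, Complex.norm_two] at hineq
  have hcard : (1 : ℝ) ≤ Fintype.card n := by exact_mod_cast hn.le
  have hσε : σ ≤ 2 * (1 + Real.sqrt ((Fintype.card n : ℝ) - 1)) * ε := le_of_sq_entry_ineq hε0 hcard hineq
  -- `2t/π ≤ σ ≤ 2(1+q) N ρ`
  have hq0 : 0 ≤ Real.sqrt ((Fintype.card n : ℝ) - 1) := Real.sqrt_nonneg _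
  have hN0 : (0 : ℝ) < N := by exact_mod_cast hN
  have hpi := Real.pi_pos
  rw [div_le_iff₀ (by positivity)]
  have h1 : 2 / Real.pi * t ≤ 2 * (1 + Real.sqrt ((Fintype.card n : ℝ) - 1)) * ((N : ℝ) * ρ) := hσlow.trans hσε
  have h2 := mul_le_mul_of_nonneg_left h1 (le_of_lt (half_pos hpi))
  have e3 : Real.pi / 2 * (2 / Real.pi * t) = t := by field_simp
  rw [e3] at h2
  nlinarith

end Witness

/-! ## §3 In F29's currency: the threshold of `exists_flat_near` is `O(ε′∕N)` and `O(N²ε′²)` -/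

section F29

variable [Nonempty n]

/-- For unitary `F(b)`, the relative distance `‖F(b)⁻¹V(b) − 1‖` equals the bondwise distance `‖V(b) − F(b)‖`. [folklore] -/
theorem norm_inv_mul_sub_one_eq {f v : (Matrix n n ℂ)ˣ} (hf : f ∈ unitaryUnits (Matrix n n ℂ)) :
    ‖(((f⁻¹ : (Matrix n n ℂ)ˣ)) : Matrix n n ℂ) * (v : Matrix n n ℂ) - 1‖ = ‖(v : Matrix n n ℂ) - (f : Matrix n n ℂ)‖ := by
  have hf1 := mem_U1.mp (mem_U1_of_mem_unitaryUnits hf)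
  have e1 : (((f⁻¹ : (Matrix n n ℂ)ˣ)) : Matrix n n ℂ) * (v : Matrix n n ℂ) - 1 = (((f⁻¹ : (Matrix n n ℂ)ˣ)) : Matrix n n ℂ) * ((v : Matrix n n ℂ) - f) := by
    rw [mul_sub, Units.inv_mul]
  refine le_antisymm ?_ ?_
  · rw [e1]
    exact (norm_mul_le _ _).trans (by nlinarith [hf1.2, norm_nonneg ((v : Matrix n n ℂ) - f)])
  · have e2 : (v : Matrix n n ℂ) - f = (f : Matrix n n ℂ) * ((((f⁻¹ : (Matrix n n ℂ)ˣ)) : Matrix n n ℂ) * (v : Matrix n n ℂ) - 1) := by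
      rw [e1, ← mul_assoc, Units.mul_inv, one_mul]
    rw [e2]
    exact (norm_mul_le _ _).trans (by nlinarith [hf1.1, norm_nonneg ((((f⁻¹ : (Matrix n n ℂ)ˣ)) : Matrix n n ℂ) * (v : Matrix n n ℂ) - 1)])

/-- **THE RATE OF «ALMOST FLAT ⇒ NEAR FLAT» IS AT LEAST `N∕(8π)`.**  In the currency of F29 `NE7SoftDataPath.exists_flat_near` (`d = 4`): if `γ ≥ 0` is such that
EVERY `U(n)`-valued `N`-periodic `V` with `SmallField V γ` is bondwise within `ε′` (relative, no gauge) of SOME `U(n)`-valued `N`-periodic configuration with all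
plaquette variables `1`, then `N·γ∕(8π) ≤ ε′` — provided `N ≥ 2` and `N²γ ≤ 4π`.  So F29's inexplicit `γ(ε′, N, n, 4)` is `O(ε′∕N)`: NOT uniform in the torus size
(part 2's triangle-wave witness). [folklore] -/
theorem exists_flat_near_rate_ge {N : ℕ} (hN : 2 ≤ N) {γ ε' : ℝ} (hγ : 0 ≤ γ) (hγN : (N : ℝ) ^ 2 * γ ≤ 4 * Real.pi)
    (hnear : ∀ V : Site 4 → Fin 4 → (Matrix n n ℂ)ˣ, IsUnitaryCfg V → IsPeriodicCfg V (N : ℤ) → SmallField V γ →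
      ∃ F : Site 4 → Fin 4 → (Matrix n n ℂ)ˣ, IsUnitaryCfg F ∧ IsPeriodicCfg F (N : ℤ) ∧
        (∀ (x : Site 4) (κ μ : Fin 4), κ ≠ μ → hol F x (plaqWord κ μ) = 1) ∧
        ∀ (x : Site 4) (κ : Fin 4), ‖(((F x κ)⁻¹ : (Matrix n n ℂ)ˣ) : Matrix n n ℂ) * (V x κ : Matrix n n ℂ) - 1‖ ≤ ε') :
    (N : ℝ) * γ / (8 * Real.pi) ≤ ε' := by
  obtain ⟨V, hVu, hVP, hVs, -, hfar⟩ := exists_smallField_far_from_flat (n := n) hN hγ hγN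
  obtain ⟨F, hFu, -, hflat, hε⟩ := hnear V hVu hVP hVs
  refine hfar F hFu hflat (fun _ => 1) (fun _ => (unitaryUnits _).one_mem) ε' fun x κ => ?_
  have hg : gaugeAct (fun _ : Site 4 => (1 : (Matrix n n ℂ)ˣ)) V x κ = V x κ := by simp [gaugeAct]
  rw [hg, ← norm_inv_mul_sub_one_eq (hFu x κ)]
  exact hε x κ

omit [Nonempty n] in
/-- **«ALMOST FLAT ⇒ NEAR FLAT» IS NOT LINEAR IN THE TARGET RADIUS.**  In the same currency, for `card n ≥ 2` and `N ≥ 1`: if `0 ≤ γ ≤ 2π²` is such that every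
`U(n)`-valued `N`-periodic `V` with `SmallField V γ` is bondwise within `ε′` (relative, no gauge) of some `U(n)`-valued `N`-periodic configuration with all plaquette
variables `1`, then `√(γ∕2) ≤ π·(1 + √(card n − 1))·N·ε′`, i.e. `γ ≤ 2π²(1 + √(card n − 1))²·N²·ε′²` — quadratic, not linear, in `ε′` (§2's witness at
`t = √(γ∕2)`). [folklore] -/
theorem exists_flat_near_not_linear (hn : 1 < Fintype.card n) {N : ℕ} (hN : 1 ≤ N) {γ ε' : ℝ} (hγ : 0 ≤ γ) (hγπ : γ ≤ 2 * Real.pi ^ 2)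
    (hnear : ∀ V : Site 4 → Fin 4 → (Matrix n n ℂ)ˣ, IsUnitaryCfg V → IsPeriodicCfg V (N : ℤ) → SmallField V γ →
      ∃ F : Site 4 → Fin 4 → (Matrix n n ℂ)ˣ, IsUnitaryCfg F ∧ IsPeriodicCfg F (N : ℤ) ∧
        (∀ (x : Site 4) (κ μ : Fin 4), κ ≠ μ → hol F x (plaqWord κ μ) = 1) ∧
        ∀ (x : Site 4) (κ : Fin 4), ‖(((F x κ)⁻¹ : (Matrix n n ℂ)ˣ) : Matrix n n ℂ) * (V x κ : Matrix n n ℂ) - 1‖ ≤ ε') :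
    Real.sqrt (γ / 2) ≤ Real.pi * (1 + Real.sqrt ((Fintype.card n : ℝ) - 1)) * N * ε' := by
  obtain ⟨i₀, -, -⟩ := Fintype.exists_pair_of_one_lt_card hn
  haveI : Nonempty n := ⟨i₀⟩
  set t : ℝ := Real.sqrt (γ / 2) with ht
  have ht0 : 0 ≤ t := Real.sqrt_nonneg _
  have htt : t ^ 2 = γ / 2 := Real.sq_sqrt (by positivity)
  have htπ : t ≤ Real.pi := by
    calc t = Real.sqrt (γ / 2) := ht
      _ ≤ Real.sqrt (Real.pi ^ 2) := Real.sqrt_le_sqrt (by nlinarith [Real.pi_pos])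
      _ = Real.pi := Real.sqrt_sq Real.pi_pos.le
  obtain ⟨V, hVu, hVP, hVs, -, hfar⟩ := exists_smallField_far_from_flat_sqrt (n := n) hn hN ht0 htπ
  have hVs' : SmallField V γ := by rw [show γ = 2 * t ^ 2 by rw [htt]; ring]; exact hVs
  obtain ⟨F, hFu, hFP, hflat, hε⟩ := hnear V hVu hVP hVs'
  have h1 := hfar F hFu hFP hflat (fun _ => 1) (fun _ => (unitaryUnits _).one_mem) (fun _ _ => rfl) ε' fun x κ => by
    have hg : gaugeAct (fun _ : Site 4 => (1 : (Matrix n n ℂ)ˣ)) V x κ = V x κ := by simp [gaugeAct]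
    rw [hg, ← norm_inv_mul_sub_one_eq (hFu x κ)]
    exact hε x κ
  have hpos : 0 < Real.pi * (1 + Real.sqrt ((Fintype.card n : ℝ) - 1)) * N := by
    have hq0 : 0 ≤ Real.sqrt ((Fintype.card n : ℝ) - 1) := Real.sqrt_nonneg _
    have hN0 : (0 : ℝ) < N := by exact_mod_cast hN
    have := Real.pi_pos
    positivity
  rwa [div_le_iff₀ hpos, mul_comm] at h1

end F29

end

end Summit.QuantumFields.BalabanUV.T4Continuum.NE7NearFlatSharpHolonomy
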